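import Summits.AtomisticToContinuum.FouriersLaw.Theses.BondHeatUncertainty
import Summits.AtomisticToContinuum.FouriersLaw.Theses.JunctionLocality
import Summits.AtomisticToContinuum.FouriersLaw.Theorems.BondHeatUncertaintyTransferToNonBallistic
import Summits.AtomisticToContinuum.FouriersLaw.Theorems.BondHeatUncertaintyLinearResponseFTUR
import Summits.AtomisticToContinuum.FouriersLaw.Theorems.JunctionLocalitySuperadditiveFekete
import Summits.AtomisticToContinuum.FouriersLaw.Theorems.OddSectorIrreversibilityBoundedResponseConvergesStubPositiveConductance
import Summits.AtomisticToContinuum.FouriersLaw.Theorems.EmbeddedDrudeMourreNessUnique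
import Summits.AtomisticToContinuum.FouriersLaw.Theorems.FourierGreenKuboFourierFiniteResponseOfUnique

/-!
# Crux-strategist r1 — ROUTE-LEVEL REDIRECT PREVIEW for route `BondHeatUncertainty` (nothing applied; `closes` untouched)

Kernel-checked evidence for recommendation R-r1-1 of `Cruxes/SubdiffusiveBondHeat/STRATEGY-CENSUS.md` (r1):
the route's LIGHT-CONE RUNG (`LightConeBondHeat` 9123 ∧ `ExtensiveSnapshotIrreversibility` 9121 ⟹ `NonBallistic` 9127, transfer
`transferToNonBallistic_proof` 9656 PROVED, engine `LinearResponseFTUR_proof` 9122 PROVED) composes with the two OTHER cruxes of the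
open sibling route `JunctionLocality` — (A) `SuperadditiveResistance` (stmt-11748) and (C) `ConductanceLowerBound` (stmt-11749) — and that
route's PROVED glue (`superadditiveFekete_proof` 11751, `positiveConductance_holds` 11750, `nessUnique_proof` 0741,
`finiteResponseOfUnique_holds` 0717) to decide the sub-problem Statement `FouriersLaw` WITHOUT the crux (S) `SubdiffusiveBondHeat`
(stmt-9120) and without its Ohm-free Edwards–Wilkinson-transient factor.  The shared decls (`NonBallistic`, `NessUnique`,
`FiniteResponseOfUnique`) are syntactically identical across the two route files, so the composition is definitional.

If the tenure planner adopts it: add 11748 / 11749 to route BondHeatUncertainty as shared items (same signatures), then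
`ledger route edit route-AtomisticToContinuum-BondHeatUncertainty --closes-file <this theorem restated over the route's own decls>`
and `--drop SubdiffusiveBondHeat` (9120 becomes moot; TransferToBoundedResponse 9655 stays as a proved aside).
-/

namespace Summit.AtomisticToContinuum.FouriersLaw.Theses.BondHeatUncertainty

/-- **Light-cone rung ⟹ (B) of `JunctionLocality`.**  `LightConeBondHeat` (9123) and `ExtensiveSnapshotIrreversibility` (9121) give
`NonBallistic` (9127 — the SAME item in both routes) through the proved transfer 9656, the proved fluctuation-theorem engine (★) 9122 and
proved weak-NESS uniqueness 0741. -/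
theorem nonBallistic_of_lightCone (hLC : LightConeBondHeat) (hK : ExtensiveSnapshotIrreversibility) :
    Summit.AtomisticToContinuum.FouriersLaw.Theses.JunctionLocality.NonBallistic :=
  Summit.AtomisticToContinuum.FouriersLaw.Theorems.transferToNonBallistic_proof hLC hK
    Summit.AtomisticToContinuum.FouriersLaw.Theorems.LinearResponseFTUR_proof
    Summit.AtomisticToContinuum.FouriersLaw.Theorems.nessUnique_proof

/-- **REPOINTED DECIDING THEOREM (preview).**  The light-cone equilibrium EW law (9123), extensive snapshot irreversibility (9121),
junction superadditivity of the resistance (11748) and the Ohmic lower bound (11749) decide `FouriersLaw`; everything else is proved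
in tree.  Compare the route's current `closes`, which consumes `SubdiffusiveBondHeat` (9120) only to obtain `BoundedResponse`, and
`BoundedResponse` is what (11748) + `NonBallistic` already give (Fekete). -/
theorem closes_repointed (hLC : LightConeBondHeat) (hK : ExtensiveSnapshotIrreversibility)
    (hA : Summit.AtomisticToContinuum.FouriersLaw.Theses.JunctionLocality.SuperadditiveResistance)
    (hC : Summit.AtomisticToContinuum.FouriersLaw.Theses.JunctionLocality.ConductanceLowerBound) :
    FouriersLaw :=
  Summit.AtomisticToContinuum.FouriersLaw.Theses.JunctionLocality.closes
    Summit.AtomisticToContinuum.FouriersLaw.Theorems.superadditiveFekete_proof hA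
    (nonBallistic_of_lightCone hLC hK) hC
    Summit.AtomisticToContinuum.FouriersLaw.Cruxes.BoundedResponseConverges.TwoScaleGluingLogRigidity.Stubs.positiveConductance_holds
    Summit.AtomisticToContinuum.FouriersLaw.Theorems.nessUnique_proof
    Summit.AtomisticToContinuum.FouriersLaw.Theorems.FourierGreenKubo.finiteResponseOfUnique_holds

end Summit.AtomisticToContinuum.FouriersLaw.Theses.BondHeatUncertainty
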